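import Summits.Langlands.Langlands.Theses.OrdinaryPrimeTransport
import Literature.NumberTheory.Automorphic.FontaineMazurGL2WeightOne
import Literature.NumberTheory.GaloisRepresentations.WeilDeligneOfGaloisUnramifiedProofs
import HarnessLib

/-!
# SKELETON — line `CGWeightOneLiftingSplitTR` for the crux `ReciprocityUpToIrreducibility`
# (item stmt-Langlands-14328; routes IrreducibilityBySelfDuality / OrdinaryPrimeTransport)
# forward generator G4 ladder-down, generation 34 (unit fwd2-ladder-Langlands-14328-g34)

Dial θ34 = the BASE FIELD of the CALEGARI–GERAGHTY weight-one lifting theorem — modularity lifting for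
`ρ : Γ_F → GL₂(ℚ̄_p)` UNRAMIFIED at every place above `p` with NO `p`-distinguishedness / local-genericity
hypothesis (the "notoriously difficult case" settled over `ℚ` by Calegari–Geraghty, Invent. Math. 211 (2018)
Cor. 1.4 (minimal) and Calegari, J. reine angew. Math. 740 (2018) Thm. 1.1 (non-minimal) by patching the
COHERENT cohomology of modular curves in weight one in two degrees, positive defect `l₀ = 1`):

* `θ = 0` — `F = ℚ`: `CGWeightOneLiftingQ` — IN PRINT: Calegari 2018 Thm. 1.1 (held text arXiv:1502.00029
  p. 3: "Let `p > 2`, and let `ρ : G_ℚ → GL₂(𝒪)` be a continuous odd Galois representation ramified at finitely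
  many primes and unramified at `p`.  Suppose that `ρ̄` is absolutely irreducible.  If `ρ` is ramified at a
  prime `ℓ`, assume that `ρ|D_ℓ` is reducible.  Then `ρ` is modular of weight one.") — the FLOOR
  (`floor_zero`, from the verbatim local copy `Calegari2018Floor` of the named fact
  `Literature.NumberTheory.Automorphic.Calegari2018_weightOneLifting_unramifiedAtP`, vendored this generation).
* `θ = 1` — `F` TOTALLY REAL, `p > 2` SPLIT COMPLETELY in `F`, same hypotheses place by place above `p`, plus
  residual automorphy (which over `ℚ` is Khare–Wintenberger): `CGWeightOneLiftingSplitTR` = THE RUNG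
  (`stub_rung`).  OPEN: Deo–Dimitrov–Wiese (arXiv:1911.11196, pp. 3–4) "address the corresponding question for
  parallel weight 1 Hilbert modular forms over a totally real field `F` of degree `d ≥ 2`" and obtain only
  `R^S_{F,ρ̄} ↠ 𝕋^{(1)}_{ρ̄}`, "a first step towards an `R = 𝕋` theorem"; every printed parallel-weight-one
  lifting theorem over `F ≠ ℚ` (Kassaei 2013, Kassaei–Sasaki–Tian 2014 Thms. 1–2, Pilloni–Stroh 2016, Sasaki 2019)
  assumes `ρ|D_𝔭` is the sum of two characters DISTINCT modulo `𝔪` (`p`-distinguished), the hypothesis absent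
  here; Calegari (loc. cit. p. 3): unramifiedness at `p` "seems essential for the method (if one does not use
  base change)".  At a completely split `p` Grossi's higher Hida theory for Hilbert modular varieties
  (arXiv:2106.05666) supplies the integral coherent complexes in degrees `[0, d]`, `d = [F:ℚ] = l₀`.
* `θ ≥ 2` — `F` totally real, ANY odd `p` (ramification index and residue degree free): `CGWeightOneLiftingTR`
  (not a stub of this line: it sits in the off-sector complement).

The lever the rung isolates: Calegari–Geraghty patching in POSITIVE DEFECT `l₀ = [F:ℚ]` for the coherent
cohomology `RΓ(X_F, ω)` of Hilbert modular varieties in parallel weight one — torsion Galois representations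
with local–global compatibility at `v ∣ p` for ALL degrees `0 ≤ i ≤ d` (Emerton–Reduzzi–Xiao; Deo–Dimitrov–Wiese
for `i = 0`) and concentration of the patched complex in the range `[0, l₀]`.

Three registered stubs and the kernel-checked composition `ReciprocityUpToIrreducibility_of` concluding the crux
BY NAME — TREE COPY convention of g14–g33: this file concludes route OrdinaryPrimeTransport's decl
`Summit.Langlands.Langlands.Theses.OrdinaryPrimeTransport.ReciprocityUpToIrreducibility` of the shared item
stmt-Langlands-14328 (the IrreducibilityBySelfDuality decl is the same text, `Iff.rfl`; the seat-folder original,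
identical up to the import `Summits.Langlands.Langlands.Theses.IrreducibilityBySelfDuality` and the concluding type,
checks rc 0 with audit proof-of-item for route-Langlands-IrreducibilityBySelfDuality, but that module could not be
served coherently by the farm at publication time — `remote:incoherent … IrreducibilityBySelfDuality: mismatch`,
2026-08-20):

* `stub_rung : CGWeightOneLiftingSplitTR` — THE RUNG (first open cell of the dial);
* `stub_sectorMerge : CGWeightOneLiftingSplitTR → SectorGaloisToAutomorphic` — upgrade a.e.-Satake automorphy on
  the sector to clause (B) of E VERBATIM (`Corresponds Rec ι π ρ`: local–global compatibility at every finite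
  place, at `v ∣ ℓ` against the PINNED Fontaine datum `Rec.pst = fontainePstAdicCompletion`) for every `Rec` —
  this is where the line honours `Cruxes/ReciprocityUpToIrreducibility/Disproof.lean` §B–§C (the crux DECIDES
  the `WDTrivialClause` of the pinned datum; for the sector's `ρ`, unramified above `ℓ`, the Weil–Deligne side
  has `N = 0` and unramified `r`, `PstWeilDeligneData.unramified_compat`);
* `stub_offSector : OffSectorReciprocity` — E with clause (B) for `n = 2` restricted OFF the sector (the honest
  complement: clause (A′) entire, `n ≠ 2`, and every `ρ` not in the sector).

Sorry-free: dial monotonicity (`splitTR_of_TR`, `rat_of_splitTR`, `primeSplitsCompletely_rat`), the floor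
instantiation `floor_zero`, ON-PATH `CGWeightOneLiftingSplitTR_of_Langlands` (the summit implies the rung:
unramified above `p` ⇒ de Rham for EVERY `p`-adic Hodge datum, `PstWeilDeligneData.isDeRhamFramed_of_isLocallyUnramified`)
and `CGWeightOneLiftingSplitTR_of_top` (the crux implies the rung).
-/

noncomputable section

set_option linter.dupNamespace false

open scoped MatrixGroups Matrix NumberField Classical
open NumberField IsDedekindDomain Field Filter
open Literature.NumberTheory.Automorphic Literature.NumberTheory.GaloisRepresentations
open Literature.NumberTheory.PAdicHodge
open Summit.Langlands

namespace Summit.Langlands.Langlands.Cruxes.ReciprocityUpToIrreducibility.CGWeightOneLiftingSplitTR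

/-! ## 1. The clauses -/

/-- **`p` splits completely in `F`**: `p ∤ d_F` and every place `v ∣ p` has residue field `𝔽_p` — the two
clauses of the tree's fact `Tung2021_hilbertTotallySplit` verbatim.  Equivalently `F_v = ℚ_p` for all `v ∣ p`.
[cite: Tung2021, Thm. 4.5] -/
def PrimeSplitsCompletely (F : Type) [Field F] [NumberField F] (p : ℕ) : Prop :=
  ¬ ((p : ℤ) ∣ NumberField.discr F) ∧
    ∀ v : HeightOneSpectrum (𝓞 F), ((p : ℕ) : 𝓞 F) ∈ v.asIdeal → v.residueCard = p

/-- **`ρ̄` is automorphic** (the residual-automorphy clause of `Tung2021_hilbertTotallySplit` /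
`BLGGT2014_thm421_GL2_totallyReal` verbatim): some `ρ₀ ≡ ρ (mod 𝔪)` (trace congruence) is attached at almost
all places, through `ι`, to a cuspidal `π₀` of `GL₂(𝔸_F)` that is `L`-algebraic with a REGULAR infinity type
(a Hilbert eigenform of cohomological weight).  Over `F = ℚ` this follows from the other hypotheses by Serre's
conjecture (Khare–Wintenberger); over `F ≠ ℚ` it is the lifting theorem's input. -/
def ResiduallyAutomorphic (F : Type) [Field F] [NumberField F] (p : ℕ) [Fact p.Prime]
    (hcpt : isCompact_glFiniteIntegralLevel 2 F) (ι : PadicAlgCl p ≃+* ℂ)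
    (ρ : FramedGaloisRep F (PadicAlgCl p) 2) : Prop :=
  ∃ (π₀ : CuspidalAutomorphicRepData 2 F hcpt) (ρ₀ : FramedGaloisRep F (PadicAlgCl p) 2),
    π₀.1.IsLAlgebraic ∧ (∃ T : InfinityType F 2, π₀.1.HasInfinityType T ∧ T.IsRegular) ∧
    SatakeFrobCompatibleAE ι π₀.1 ρ₀ ∧ ∀ σ, ‖(ρ σ).val.trace - (ρ₀ σ).val.trace‖ < 1

/-- **The Calegari–Geraghty weight-one lifting statement at `(F, p, hcpt, ι, ρ)`** — Calegari 2018 Thm. 1.1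
transported verbatim from `ℚ` to `F`, plus residual automorphy: for `ρ : Γ_F → GL₂(ℚ̄_p)` continuous, ramified
at finitely many places, UNRAMIFIED AT EVERY `v ∣ p` (no distinguishedness, no genericity), irreducible,
TOTALLY ODD, with `ρ̄` absolutely irreducible, such that `ρ|Γ_{F_v}` is REDUCIBLE at every ramified `v ∤ p`
("if `ρ` is ramified at a prime `ℓ`, assume that `ρ|D_ℓ` is reducible"), and residually automorphic, there is an
`L`-algebraic cuspidal `π` of `GL₂(𝔸_F)` attached to `ρ` at almost all places (expected: a parallel-weight-one
Hilbert eigenform; Rogawski–Tunnell).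
[cite: Calegari2018NonMinimalWeightOne, Thm. 1.1] [cite: CalegariGeraghty2017, Cor. 1.4] -/
def LiftsAt (F : Type) [Field F] [NumberField F] (p : ℕ) [Fact p.Prime]
    (hcpt : isCompact_glFiniteIntegralLevel 2 F) (ι : PadicAlgCl p ≃+* ℂ)
    (ρ : FramedGaloisRep F (PadicAlgCl p) 2) : Prop :=
  (∀ᶠ v : HeightOneSpectrum (𝓞 F) in cofinite, ρ.IsUnramifiedAt v) →
  (∀ v : HeightOneSpectrum (𝓞 F), ((p : ℕ) : 𝓞 F) ∈ v.asIdeal → ρ.IsUnramifiedAt v) →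
  ρ.toGaloisRep.IsIrreducible → ρ.IsOdd → ρ.IsResiduallyAbsIrreducible →
  (∀ v : HeightOneSpectrum (𝓞 F), ((p : ℕ) : 𝓞 F) ∉ v.asIdeal → ¬ ρ.IsUnramifiedAt v →
      ¬ (ρ.toLocal v).toGaloisRep.IsIrreducible) →
  ResiduallyAutomorphic F p hcpt ι ρ →
  ∃ π : CuspidalAutomorphicRepData 2 F hcpt, π.1.IsLAlgebraic ∧ SatakeFrobCompatibleAE ι π.1 ρ

/-! ## 2. The family graded by the base-field dial `θ` -/

/-- **Cell `θ = 0`** — `F = ℚ` (the FLOOR cell; Calegari's theorem with the residual-automorphy hypothesis added,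
which over `ℚ` is redundant). -/
def CGWeightOneLiftingQ : Prop :=
  ∀ (p : ℕ) [Fact p.Prime], p ≠ 2 →
    ∀ (hcpt : isCompact_glFiniteIntegralLevel 2 ℚ) (ι : PadicAlgCl p ≃+* ℂ)
      (ρ : FramedGaloisRep ℚ (PadicAlgCl p) 2), LiftsAt ℚ p hcpt ι ρ

/-- **THE RUNG `θ = 1`** — Calegari–Geraghty weight-one lifting for `GL₂` over TOTALLY REAL `F` at an odd prime
`p` SPLIT COMPLETELY in `F` (`F_v = ℚ_p` at every `v ∣ p`; Grossi's higher Hida theory is available exactly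
here).  OPEN (Deo–Dimitrov–Wiese: "a first step towards an `R = 𝕋` theorem"). -/
def CGWeightOneLiftingSplitTR : Prop :=
  ∀ (F : Type) [Field F] [NumberField F], IsTotallyReal F → ∀ (p : ℕ) [Fact p.Prime], p ≠ 2 →
    PrimeSplitsCompletely F p →
    ∀ (hcpt : isCompact_glFiniteIntegralLevel 2 F) (ι : PadicAlgCl p ≃+* ℂ)
      (ρ : FramedGaloisRep F (PadicAlgCl p) 2), LiftsAt F p hcpt ι ρ

/-- **Cell `θ ≥ 2`** — every totally real `F`, every odd `p` (no splitting condition).  OPEN; not a stub of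
this line. -/
def CGWeightOneLiftingTR : Prop :=
  ∀ (F : Type) [Field F] [NumberField F], IsTotallyReal F → ∀ (p : ℕ) [Fact p.Prime], p ≠ 2 →
    ∀ (hcpt : isCompact_glFiniteIntegralLevel 2 F) (ι : PadicAlgCl p ≃+* ℂ)
      (ρ : FramedGaloisRep F (PadicAlgCl p) 2), LiftsAt F p hcpt ι ρ

/-- **The rung family** `E(θ)`: `E(0)` = over `ℚ` (floor, in print), `E(1)` = totally real with `p` split
completely (THE RUNG), `E(θ)` for `θ ≥ 2` = all totally real fields and odd primes.
[cite: Calegari2018NonMinimalWeightOne, Thm. 1.1] -/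
def CGWeightOneLifting : ℕ → Prop
  | 0 => CGWeightOneLiftingQ
  | 1 => CGWeightOneLiftingSplitTR
  | _ => CGWeightOneLiftingTR

theorem family_zero : CGWeightOneLifting 0 = CGWeightOneLiftingQ := rfl

theorem family_one : CGWeightOneLifting 1 = CGWeightOneLiftingSplitTR := rfl

theorem family_of_two_le {θ : ℕ} (h : 2 ≤ θ) : CGWeightOneLifting θ = CGWeightOneLiftingTR := by
  match θ, h with
  | (k + 2), _ => rfl

/-! ## 3. Dial monotonicity and the floor -/

/-- Every prime splits completely in `ℚ`: `d_ℚ = 1` (Mathlib `Rat.numberField_discr`) and a place `v ∋ p` of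
`ℚ` has `q_v ∣ N((p)) = p` (Mathlib `Ideal.absNorm_dvd_absNorm_of_le`, `Algebra.norm_algebraMap`), so
`q_v = p`. [folklore] -/
theorem primeSplitsCompletely_rat (p : ℕ) [hp : Fact p.Prime] : PrimeSplitsCompletely ℚ p := by
  refine ⟨?_, fun v hv => ?_⟩
  · rw [Rat.numberField_discr]
    intro h
    have h1 : (p : ℤ) ≤ 1 := Int.le_of_dvd one_pos h
    have h2 : 1 < p := hp.out.one_lt
    omega
  · have h1 : Ideal.absNorm v.asIdeal ∣ Ideal.absNorm (Ideal.span {((p : ℕ) : 𝓞 ℚ)}) :=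
      Ideal.absNorm_dvd_absNorm_of_le ((Ideal.span_singleton_le_iff_mem _).mpr hv)
    rw [Ideal.absNorm_span_singleton, show ((p : ℕ) : 𝓞 ℚ) = algebraMap ℤ (𝓞 ℚ) (p : ℤ) by simp,
      Algebra.norm_algebraMap, NumberField.RingOfIntegers.rank, Module.finrank_self, pow_one,
      Int.natAbs_natCast] at h1
    exact ((Nat.dvd_prime hp.out).mp h1).resolve_left v.one_lt_residueCard.ne'

/-- Dial monotonicity `θ ≥ 2 ⇒ θ = 1`: drop the splitting hypothesis. -/
theorem splitTR_of_TR (h : CGWeightOneLiftingTR) : CGWeightOneLiftingSplitTR :=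
  fun F _ _ hF p _ hp _ hcpt ι ρ => h F hF p hp hcpt ι ρ

/-- Dial monotonicity `θ = 1 ⇒ θ = 0`: `ℚ` is totally real and every prime splits completely in it. -/
theorem rat_of_splitTR (h : CGWeightOneLiftingSplitTR) : CGWeightOneLiftingQ :=
  fun p _ hp hcpt ι ρ => h ℚ inferInstance p hp (primeSplitsCompletely_rat p) hcpt ι ρ

/-- The family is monotone in the dial. -/
theorem mono {θ θ' : ℕ} (hle : θ ≤ θ') (h : CGWeightOneLifting θ') : CGWeightOneLifting θ := by
  rcases Nat.lt_or_ge θ' 2 with hθ' | hθ'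
  · interval_cases θ' <;> interval_cases θ
    · exact h
    · exact rat_of_splitTR h
    · exact h
  · rw [family_of_two_le hθ'] at h
    rcases Nat.lt_or_ge θ 2 with hθ | hθ
    · interval_cases θ
      · exact rat_of_splitTR (splitTR_of_TR h)
      · exact splitTR_of_TR h
    · rw [family_of_two_le hθ]; exact h

/-- **The floor fact, verbatim** — the statement of the named fact
`Literature.NumberTheory.Automorphic.Calegari2018_weightOneLifting_unramifiedAtP` (Calegari, J. reine angew.
Math. 740 (2018) Thm. 1.1, rendered in the summit's vocabulary: conclusion = an `L`-algebraic cuspidal `π` of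
`GL₂(𝔸_ℚ)` with Satake–Frobenius matching a.e.), copied here so that this skeleton elaborates independently of
the fact file (proposed to `Literature/NumberTheory/Automorphic/WeightOneLiftingUnramifiedAtP.lean` this
generation).  [cite: Calegari2018NonMinimalWeightOne, Thm. 1.1] -/
def Calegari2018Floor : Prop :=
  ∀ (p : ℕ) [Fact p.Prime], p ≠ 2 →
    ∀ (ρ : FramedGaloisRep ℚ (PadicAlgCl p) 2),
      (∀ᶠ v : HeightOneSpectrum (𝓞 ℚ) in cofinite, ρ.IsUnramifiedAt v) →
      (∀ v : HeightOneSpectrum (𝓞 ℚ), ((p : ℕ) : 𝓞 ℚ) ∈ v.asIdeal → ρ.IsUnramifiedAt v) →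
      ρ.toGaloisRep.IsIrreducible → ρ.IsOdd → ρ.IsResiduallyAbsIrreducible →
      (∀ v : HeightOneSpectrum (𝓞 ℚ), ((p : ℕ) : 𝓞 ℚ) ∉ v.asIdeal → ¬ ρ.IsUnramifiedAt v →
          ¬ (ρ.toLocal v).toGaloisRep.IsIrreducible) →
      ∀ (hcpt : isCompact_glFiniteIntegralLevel 2 ℚ) (ι : PadicAlgCl p ≃+* ℂ),
        ∃ π : CuspidalAutomorphicRepData 2 ℚ hcpt, π.1.IsLAlgebraic ∧ SatakeFrobCompatibleAE ι π.1 ρ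

/-- **FLOOR (F3)**: Calegari 2018 Thm. 1.1 (the named fact, verbatim) gives the cell `θ = 0` (the
residual-automorphy hypothesis is simply not used over `ℚ`). [cite: Calegari2018NonMinimalWeightOne, Thm. 1.1] -/
theorem floor_zero (h : Calegari2018Floor) : CGWeightOneLifting 0 := by
  show CGWeightOneLiftingQ
  intro p _ hp hcpt ι ρ hunr hunrp hirr hodd hres hred _haut
  exact h p hp ρ hunr hunrp hirr hodd hres hred hcpt ι

example (h : Calegari2018Floor) : CGWeightOneLifting 0 := by simpa using floor_zero h

/-- The rung is the family at `θ = 1`. -/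
theorem rung_iff_family_one : CGWeightOneLiftingSplitTR ↔ CGWeightOneLifting 1 := Iff.rfl

/-! ## 4. ON-PATH (F4): the summit implies every cell (sorry-free) -/

/-- **Unramified above `p` ⇒ de Rham for every datum**: `ρ` unramified at `v` kills the local inertia group
(`FramedGaloisRep.toLocal_eq_one_of_mem_absInertia`), and a locally unramified representation is de Rham for
EVERY `p`-adic Hodge datum (`PstWeilDeligneData.isDeRhamFramed_of_isLocallyUnramified`, a structure field). -/
theorem isDeRhamFramed_of_isUnramifiedAt {F : Type} [Field F] [NumberField F] {p : ℕ} [Fact p.Prime]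
    (ρ : FramedGaloisRep F (PadicAlgCl p) 2) {v : HeightOneSpectrum (𝓞 F)} (hρ : ρ.IsUnramifiedAt v)
    (𝔇 : PstWeilDeligneData (v.adicCompletion F) p) : 𝔇.IsDeRhamFramed (ρ.toLocal v) :=
  𝔇.isDeRhamFramed_of_isLocallyUnramified fun _σ hσ => ρ.toLocal_eq_one_of_mem_absInertia hρ hσ

/-- `Langlands → LiftsAt F p hcpt ι ρ` for every datum: clause (B) of the summit at any reciprocity datum (one
exists by the `Nonempty` conjunct) applies to `ρ` — geometric because `ρ` is a.e. unramified (hypothesis) and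
unramified, hence de Rham for `Rec.pst p v hv`, at every `v ∣ p`; `Corresponds Rec ι π ρ` has
`SatakeFrobCompatibleAE ι π ρ` as its first conjunct.  Oddness and the residual clauses are not used. -/
theorem liftsAt_of_langlands (hL : _root_.Langlands) (F : Type) [Field F] [NumberField F] (p : ℕ)
    [Fact p.Prime] (hcpt : isCompact_glFiniteIntegralLevel 2 F) (ι : PadicAlgCl p ≃+* ℂ)
    (ρ : FramedGaloisRep F (PadicAlgCl p) 2) : LiftsAt F p hcpt ι ρ := by
  intro hunr hunrp hirr _hodd _hres _hred _haut
  obtain ⟨⟨Rec⟩, hall⟩ := hL F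
  have hB : GaloisToAutomorphic 2 Rec hcpt := (hall Rec 2 two_pos hcpt).2
  have hdR : ∀ (v : HeightOneSpectrum (𝓞 F)) (hv : ((p : ℕ) : 𝓞 F) ∈ v.asIdeal),
      (Rec.pst p v hv).IsDeRhamFramed (ρ.toLocal v) :=
    fun v hv => isDeRhamFramed_of_isUnramifiedAt ρ (hunrp v hv) (Rec.pst p v hv)
  obtain ⟨π, hπL, hcorr⟩ := hB p ι ρ hirr ⟨hunr, hdR⟩
  refine ⟨π, hπL, ?_⟩
  filter_upwards [hcorr.1] with v hv
  exact hv

/-- ON-PATH for the cell `θ ≥ 2`. -/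
theorem CGWeightOneLiftingTR_of_Langlands (hL : _root_.Langlands) : CGWeightOneLiftingTR :=
  fun F _ _ _ p _ _ hcpt ι ρ => liftsAt_of_langlands hL F p hcpt ι ρ

/-- **F4 ON-PATH lemma for the rung**: `Langlands → CGWeightOneLiftingSplitTR`. -/
@[aesop safe apply]
theorem CGWeightOneLiftingSplitTR_of_Langlands (hL : _root_.Langlands) : CGWeightOneLiftingSplitTR :=
  splitTR_of_TR (CGWeightOneLiftingTR_of_Langlands hL)

/-- ON-PATH for every cell of the family. -/
theorem family_of_langlands (θ : ℕ) (hL : _root_.Langlands) : CGWeightOneLifting θ := by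
  rcases Nat.lt_or_ge θ 2 with hθ | hθ
  · interval_cases θ
    · exact rat_of_splitTR (CGWeightOneLiftingSplitTR_of_Langlands hL)
    · exact CGWeightOneLiftingSplitTR_of_Langlands hL
  · rw [family_of_two_le hθ]; exact CGWeightOneLiftingTR_of_Langlands hL

example : _root_.Langlands → CGWeightOneLiftingSplitTR := by intro h; aesop

/-! ## 5. The sector of clause (B) carried by the rung, the merge target, the complement -/

/-- **The split Calegari–Geraghty weight-one sector of clause (B)** at `(F, hcpt, ℓ, ι, ρ)` for `n = 2`:
exactly the rung's hypotheses beyond those clause (B) brings itself (irreducible, geometric) — `F` totally real,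
`ℓ` odd and split completely in `F`, `ρ` unramified above `ℓ`, totally odd, residually absolutely irreducible,
locally reducible at its ramified places, residually automorphic. -/
def InCGWeightOneSector (F : Type) [Field F] [NumberField F] (hcpt : isCompact_glFiniteIntegralLevel 2 F)
    (ℓ : ℕ) [Fact ℓ.Prime] (ι : PadicAlgCl ℓ ≃+* ℂ) (ρ : FramedGaloisRep F (PadicAlgCl ℓ) 2) : Prop :=
  IsTotallyReal F ∧ ℓ ≠ 2 ∧ PrimeSplitsCompletely F ℓ ∧
    (∀ v : HeightOneSpectrum (𝓞 F), ((ℓ : ℕ) : 𝓞 F) ∈ v.asIdeal → ρ.IsUnramifiedAt v) ∧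
    ρ.IsOdd ∧ ρ.IsResiduallyAbsIrreducible ∧
    (∀ v : HeightOneSpectrum (𝓞 F), ((ℓ : ℕ) : 𝓞 F) ∉ v.asIdeal → ¬ ρ.IsUnramifiedAt v →
        ¬ (ρ.toLocal v).toGaloisRep.IsIrreducible) ∧
    ResiduallyAutomorphic F ℓ hcpt ι ρ

/-- **Merge target**: clause (B) of E VERBATIM (cuspidal, `L`-algebraic, `Corresponds Rec ι π ρ` — a.e. Satake
AND local–global compatibility at every finite place, at `v ∣ ℓ` against `Rec.pst`) for EVERY reciprocity datum
`Rec`, on the sector. -/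
def SectorGaloisToAutomorphic : Prop :=
  ∀ (F : Type) [Field F] [NumberField F] (Rec : ReciprocityData F) (hcpt : isCompact_glFiniteIntegralLevel 2 F)
    (ℓ : ℕ) [Fact ℓ.Prime] (ι : PadicAlgCl ℓ ≃+* ℂ) (ρ : FramedGaloisRep F (PadicAlgCl ℓ) 2),
    ρ.toGaloisRep.IsIrreducible → IsGeometricFramed Rec ρ → InCGWeightOneSector F hcpt ℓ ι ρ →
      ∃ π : CuspidalAutomorphicRepData 2 F hcpt, π.1.IsLAlgebraic ∧ Corresponds Rec ι π.1 ρ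

/-- **The off-sector complement**: E (`ReciprocityUpToIrreducibility`) with clause (A′) entire, clause (B)
entire for `n ≠ 2`, and clause (B) for `n = 2` restricted to `ρ` NOT in the sector. -/
def OffSectorReciprocity : Prop :=
  ∀ (F : Type) [Field F] [NumberField F], ∃ Rec : ReciprocityData F,
    (∀ n : ℕ, 0 < n → ∀ hcpt : isCompact_glFiniteIntegralLevel n F,
      ∀ π : CuspidalAutomorphicRepData n F hcpt, π.1.IsLAlgebraic →
        ∀ (ℓ : ℕ) [Fact ℓ.Prime] (ι : PadicAlgCl ℓ ≃+* ℂ),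
          ∃ ρ : FramedGaloisRep F (PadicAlgCl ℓ) n, IsGeometricFramed Rec ρ ∧ Corresponds Rec ι π.1 ρ) ∧
    (∀ n : ℕ, 0 < n → n ≠ 2 → ∀ hcpt : isCompact_glFiniteIntegralLevel n F, GaloisToAutomorphic n Rec hcpt) ∧
    (∀ (hcpt : isCompact_glFiniteIntegralLevel 2 F) (ℓ : ℕ) [Fact ℓ.Prime] (ι : PadicAlgCl ℓ ≃+* ℂ)
      (ρ : FramedGaloisRep F (PadicAlgCl ℓ) 2),
      ρ.toGaloisRep.IsIrreducible → IsGeometricFramed Rec ρ → ¬ InCGWeightOneSector F hcpt ℓ ι ρ →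
        ∃ π : CuspidalAutomorphicRepData 2 F hcpt, π.1.IsLAlgebraic ∧ Corresponds Rec ι π.1 ρ)

/-! ## 6. The three registered stubs -/

/-- **THE RUNG / cap-lifting input**: Calegari–Geraghty weight-one lifting for `GL₂` over totally real fields at
a completely split odd prime.  OPEN: the ceiling of the method in print is `l₀ = 1` (Calegari–Geraghty 2018 §1:
"We hope that, in the future, the methods of this paper can be adapted to the case of general `l₀`"); over `F` of
degree `d` the parallel-weight-one problem has `l₀ = d` (coherent cohomology of the Hilbert modular variety in
degrees `0, …, d`), and the inputs are (i) Galois representations with local–global compatibility at `v ∣ p` for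
TORSION classes in every degree (Deo–Dimitrov–Wiese 2019/2023: degree `0`; Emerton–Reduzzi–Xiao) and (ii)
concentration of the patched complex — Grossi's higher Hida theory at totally split `p` being the integral model. -/
theorem stub_rung : CGWeightOneLiftingSplitTR := by
  sorry

/-- Sector merge: from a.e.-Satake automorphy on the sector (the rung) to clause (B) of E verbatim on
`InCGWeightOneSector`, for every `Rec` (cuspidality is part of the rung's conclusion; local–global compatibility
at every finite place — at `v ∣ ℓ` for the pinned Fontaine datum, cf. `Disproof.lean` §B–§C, where `ρ` is
UNRAMIFIED so the attached Weil–Deligne representation is unramified with `N = 0` — is the content). -/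
theorem stub_sectorMerge : CGWeightOneLiftingSplitTR → SectorGaloisToAutomorphic := by
  sorry

/-- The honest complement: E off the sector. -/
theorem stub_offSector : OffSectorReciprocity := by
  sorry

/-! ## 7. Composition (no sorry below this line) -/

/-- **COMPOSITION — the crux BY NAME from the three stub statements.**  `Rec`, clause (A′), clause (B) for
`n ≠ 2` and clause (B) off the sector come from the off-sector statement; for `n = 2` clause (B) is a case
split on the sector, where the RUNG feeds the merge. -/
theorem ReciprocityUpToIrreducibility_of :
    CGWeightOneLiftingSplitTR → (CGWeightOneLiftingSplitTR → SectorGaloisToAutomorphic) → OffSectorReciprocity →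
    Summit.Langlands.Langlands.Theses.OrdinaryPrimeTransport.ReciprocityUpToIrreducibility := by
  intro hrung hmerge hoff F _ _
  obtain ⟨Rec, hA, hBne, hBoff⟩ := hoff F
  refine ⟨Rec, fun n hn hcpt => ⟨hA n hn hcpt, ?_⟩⟩
  intro ℓ _ ι ρ hirr hgeo
  by_cases hn2 : n = 2
  · subst hn2
    by_cases hsec : InCGWeightOneSector F hcpt ℓ ι ρ
    · exact hmerge hrung F Rec hcpt ℓ ι ρ hirr hgeo hsec
    · exact hBoff hcpt ℓ ι ρ hirr hgeo hsec
  · exact hBne n hn hn2 hcpt ℓ ι ρ hirr hgeo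

/-- **THE REGISTERED SKELETON THEOREM** — the item's decl from the three registered stubs (audit: proof-of-item
modulo the three sorries). -/
theorem ReciprocityUpToIrreducibility_proof :
    Summit.Langlands.Langlands.Theses.OrdinaryPrimeTransport.ReciprocityUpToIrreducibility :=
  ReciprocityUpToIrreducibility_of stub_rung stub_sectorMerge stub_offSector

/-- The rung from the registered stubs (it is load-bearing: `ReciprocityUpToIrreducibility_of` passes it to the
merge). -/
theorem rung_of_stubs : CGWeightOneLiftingSplitTR := stub_rung

/-! ## 8. The rung is a consequence of the top (sorry-free) -/

/-- `E → LiftsAt` for every datum (clause (B) of E for `n = 2`, for its own `Rec`). -/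
theorem liftsAt_of_top
    (hE : Summit.Langlands.Langlands.Theses.OrdinaryPrimeTransport.ReciprocityUpToIrreducibility)
    (F : Type) [Field F] [NumberField F] (p : ℕ) [Fact p.Prime] (hcpt : isCompact_glFiniteIntegralLevel 2 F)
    (ι : PadicAlgCl p ≃+* ℂ) (ρ : FramedGaloisRep F (PadicAlgCl p) 2) : LiftsAt F p hcpt ι ρ := by
  intro hunr hunrp hirr _hodd _hres _hred _haut
  obtain ⟨Rec, hall⟩ := hE F
  have hB : GaloisToAutomorphic 2 Rec hcpt := (hall 2 two_pos hcpt).2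
  have hdR : ∀ (v : HeightOneSpectrum (𝓞 F)) (hv : ((p : ℕ) : 𝓞 F) ∈ v.asIdeal),
      (Rec.pst p v hv).IsDeRhamFramed (ρ.toLocal v) :=
    fun v hv => isDeRhamFramed_of_isUnramifiedAt ρ (hunrp v hv) (Rec.pst p v hv)
  obtain ⟨π, hπL, hcorr⟩ := hB p ι ρ hirr ⟨hunr, hdR⟩
  refine ⟨π, hπL, ?_⟩
  filter_upwards [hcorr.1] with v hv
  exact hv

/-- `E → rung`. -/
theorem CGWeightOneLiftingSplitTR_of_top
    (hE : Summit.Langlands.Langlands.Theses.OrdinaryPrimeTransport.ReciprocityUpToIrreducibility) :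
    CGWeightOneLiftingSplitTR :=
  fun F _ _ _ p _ _ _ hcpt ι ρ => liftsAt_of_top hE F p hcpt ι ρ

/-- `E → every cell`. -/
theorem family_of_top (θ : ℕ)
    (hE : Summit.Langlands.Langlands.Theses.OrdinaryPrimeTransport.ReciprocityUpToIrreducibility) :
    CGWeightOneLifting θ := by
  rcases Nat.lt_or_ge θ 2 with hθ | hθ
  · interval_cases θ
    · exact rat_of_splitTR (CGWeightOneLiftingSplitTR_of_top hE)
    · exact CGWeightOneLiftingSplitTR_of_top hE
  · rw [family_of_two_le hθ]
    exact fun F _ _ _ p _ _ hcpt ι ρ => liftsAt_of_top hE F p hcpt ι ρ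

end Summit.Langlands.Langlands.Cruxes.ReciprocityUpToIrreducibility.CGWeightOneLiftingSplitTR

end
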